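import Literature.Analysis.FluidPDE.KatoLocalBoundedContinuity
import HarnessLib

/-!
# Gluing the Oseen integral equation across consecutive time slabs

Analysis/FluidPDE support file (everything proved; no definitions, no named facts).  A field
`v` which is continuous and bounded on `[a, b] × E` and satisfies the Oseen
(Koch–Nadirashvili–Seregin–Šverák) integral equation
`v(t) = e^{(t−s)Δ}v(s) − B¹ₛ(v,v)(t)` between all pairs of times of `[a, θ]` and between all
pairs of times of `[θ, b]` satisfies it between all pairs of times of `[a, b]`
(`oseenMild_glue`): for `s < θ < t`,
`e^{(t−θ)Δ}[e^{(θ−s)Δ}v(s) − B¹ₛ(θ)] − B¹_θ(t) = e^{(t−s)Δ}v(s) − B¹ₛ(t)` by the semigroup law on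
bounded data and the restart identity of the Duhamel term
`B¹ₛ(t) = e^{(t−θ)Δ}B¹ₛ(θ) + B¹_θ(t)` (`oseenDuhamel_eq_heatExtension_add_of_slab`;
KNSS 2009, §4 (4.4): the integral equation "can be treated as an ODE in `t`").
`oseenMild_chain` iterates this along a monotone sequence of slab ends `T 0 ≤ T 1 ≤ ⋯`, and
`continuousOn_uncurry_chain`, `exists_bound_chain`, `continuousOn_uncurry_Ico_of_chain` are the
accompanying pasting lemmas for continuity and bounds (concatenation of solutions defined
slab by slab, e.g. period by period for discretely self-similar data).

## Mathlib / tree search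

Tree: `oseenDuhamel_eq_heatExtension_add_of_slab`, `oseen_fixedPoint_restart` (the converse
direction), `aestronglyMeasurable_oseenDuhamel`, `exists_norm_oseenDuhamel_bounded_le`,
`heatExtension_sub_eq_of_memLp`, `UnboundedOperators.heatExtension_add_holds`,
`UnboundedOperators.memLp_heatExtension_holds`, `heatFlow_of_pos`. Mathlib:
`ContinuousOn.union_of_isClosed`, `continuousOn_of_locally_continuousOn`, `memLp_top_of_bound`.

## References

* G. Koch, N. Nadirashvili, G. Seregin, V. Šverák, Acta Math. 203 (2009) = arXiv:0709.3599,
  §4 (4.3)–(4.4). [KochNadirashviliSereginSverak2009]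
* P. G. Lemarié-Rieusset, *The Navier–Stokes Problem in the 21st Century*, CRC Press 2016,
  proof of Thm. 9.12, (9.38). [LemarieRieusset2016]
-/

noncomputable section

open MeasureTheory Set Function Filter TopologicalSpace
open _root_.Topology
open scoped ENNReal

namespace Literature.Analysis.FluidPDE

variable {E : Type*} [NormedAddCommGroup E] [InnerProductSpace ℝ E] [FiniteDimensional ℝ E]
  [MeasurableSpace E] [BorelSpace E]

/-! ### One junction -/

/-- **Gluing the Oseen equation at one junction time.** Let `v` be continuous and bounded on
`[a, b] × E` and satisfy `v(t) = e^{(t−s)Δ}v(s) − B¹ₛ(v,v)(t)` pointwise for all pairs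
`s < t` in `[a, θ]` and for all pairs in `[θ, b]`.  Then the identity holds for all pairs
`s < t` in `[a, b]`: for `s < θ < t`, apply `e^{(t−θ)Δ}` to the identity at `(s, θ)` (semigroup
law and linearity on bounded data) and use the restart identity
`B¹ₛ(t) = e^{(t−θ)Δ}B¹ₛ(θ) + B¹_θ(t)` (KNSS 2009, §4 (4.4)). [cite: KochNadirashviliSereginSverak2009, §4 (4.4) (arXiv:0709.3599)] -/
theorem oseenMild_glue {v : ℝ → E → E} {a θ b M : ℝ}
    (hcont : ContinuousOn (uncurry v) (Icc a b ×ˢ univ)) (hM : ∀ τ ∈ Icc a b, ∀ y, ‖v τ y‖ ≤ M)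
    (h1 : ∀ s t : ℝ, a ≤ s → s < t → t ≤ θ → ∀ x,
      v t x = heatFlow (v s) (t - s) x - oseenDuhamel 1 s v v t x)
    (h2 : ∀ s t : ℝ, θ ≤ s → s < t → t ≤ b → ∀ x,
      v t x = heatFlow (v s) (t - s) x - oseenDuhamel 1 s v v t x) :
    ∀ s t : ℝ, a ≤ s → s < t → t ≤ b → ∀ x,
      v t x = heatFlow (v s) (t - s) x - oseenDuhamel 1 s v v t x := by
  haveI : CompleteSpace E := FiniteDimensional.complete ℝ E
  intro s t hs hst ht x
  rcases le_or_gt t θ with htθ | hθt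
  · exact h1 s t hs hst htθ x
  rcases le_or_gt θ s with hθs | hsθ
  · exact h2 s t hθs hst ht x
  -- the interesting case `s < θ < t`
  have hsb : s ≤ b := hst.le.trans ht
  have hM0 : 0 ≤ M := (norm_nonneg _).trans (hM s ⟨hs, hsb⟩ x)
  have hmeas : AEStronglyMeasurable (uncurry v)
      ((volume : Measure (ℝ × E)).restrict (Ioo s b ×ˢ univ)) :=
    (hcont.mono (prod_mono (fun τ hτ => ⟨hs.trans hτ.1.le, hτ.2.le⟩) subset_rfl)).aestronglyMeasurable
      (measurableSet_Ioo.prod MeasurableSet.univ)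
  have hbd : ∀ τ ∈ Ioo s b, ∀ y, ‖v τ y‖ ≤ M := fun τ hτ y => hM τ ⟨hs.trans hτ.1.le, hτ.2.le⟩ y
  have hvs : Continuous (v s) :=
    hcont.comp_continuous (continuous_const.prodMk continuous_id)
      fun y => ⟨⟨hs, hsb⟩, mem_univ y⟩
  have hvs_top : MemLp (v s) ∞ (volume : Measure E) :=
    memLp_top_of_bound hvs.aestronglyMeasurable M (Eventually.of_forall fun y => hM s ⟨hs, hsb⟩ y)
  -- the Duhamel slice at `θ` is bounded and measurable
  obtain ⟨C, -, hCB⟩ := exists_norm_oseenDuhamel_bounded_le (E := E)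
  have hBθ : MemLp (oseenDuhamel 1 s v v θ) ∞ (volume : Measure E) :=
    memLp_top_of_bound
      (aestronglyMeasurable_oseenDuhamel one_pos hmeas hmeas hM0 hbd hbd hsθ (hθt.le.trans ht)) _
      (Eventually.of_forall fun y => hCB one_pos hsθ hM0
        (fun τ hτ z => hbd τ ⟨hτ.1, hτ.2.trans (hθt.trans_le ht)⟩ z)
        (fun τ hτ z => hbd τ ⟨hτ.1, hτ.2.trans (hθt.trans_le ht)⟩ z) y)
  have hU : MemLp (UnboundedOperators.heatExtension (v s) (θ - s)) ∞ (volume : Measure E) :=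
    UnboundedOperators.memLp_heatExtension_holds hvs_top le_top (sub_pos.2 hsθ)
  -- the identity at `(s, θ)` as an identity of slices
  have hslice : v θ = UnboundedOperators.heatExtension (v s) (θ - s) - oseenDuhamel 1 s v v θ := by
    funext y
    rw [Pi.sub_apply, h1 s θ hs hsθ le_rfl y, heatFlow_of_pos _ (sub_pos.2 hsθ)]
  -- apply `e^{(t-θ)Δ}`
  have hheat : UnboundedOperators.heatExtension (v θ) (t - θ) x =
      UnboundedOperators.heatExtension (v s) (t - s) x -
        UnboundedOperators.heatExtension (oseenDuhamel 1 s v v θ) (t - θ) x := by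
    rw [hslice, heatExtension_sub_eq_of_memLp hU hBθ le_top (sub_pos.2 hθt), Pi.sub_apply,
      UnboundedOperators.heatExtension_add_holds hvs_top le_top (sub_pos.2 hsθ) (sub_pos.2 hθt),
      show θ - s + (t - θ) = t - s by ring]
  -- the restart identity of the Duhamel term
  have hrestart := oseenDuhamel_eq_heatExtension_add_of_slab one_pos hmeas hmeas hM0 hM0 hbd hbd
    hsθ hθt ht x
  rw [one_mul] at hrestart
  rw [h2 θ t le_rfl hθt ht x, heatFlow_of_pos _ (sub_pos.2 hθt), heatFlow_of_pos _ (sub_pos.2 hst),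
    hheat, hrestart]
  abel

/-! ### Chains of slabs -/

/-- Continuity on consecutive closed slabs pastes to continuity on their union
`[T 0, T n] × X` (finite union of closed sets). [folklore] -/
theorem continuousOn_uncurry_chain {X Y : Type*} [TopologicalSpace X] [TopologicalSpace Y]
    {v : ℝ → X → Y} {T : ℕ → ℝ} (hT : Monotone T)
    (hcont : ∀ k, ContinuousOn (uncurry v) (Icc (T k) (T (k + 1)) ×ˢ univ)) (n : ℕ) :
    ContinuousOn (uncurry v) (Icc (T 0) (T n) ×ˢ univ) := by
  induction n with
  | zero =>
      refine (hcont 0).mono (prod_mono (Icc_subset_Icc le_rfl (hT (Nat.zero_le 1))) subset_rfl)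
  | succ n ih =>
      have hunion : Icc (T 0) (T (n + 1)) ×ˢ (univ : Set X) =
          Icc (T 0) (T n) ×ˢ univ ∪ Icc (T n) (T (n + 1)) ×ˢ univ := by
        rw [← union_prod, Icc_union_Icc_eq_Icc (hT (Nat.zero_le n)) (hT (Nat.le_succ n))]
      rw [hunion]
      exact ih.union_of_isClosed (hcont n) (isClosed_Icc.prod isClosed_univ)
        (isClosed_Icc.prod isClosed_univ)

/-- Bounds on consecutive slabs give a bound on `[T 0, T n]`. [folklore] -/
theorem exists_bound_chain {X F : Type*} [SeminormedAddCommGroup F] {v : ℝ → X → F} {T : ℕ → ℝ}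
    (hT : Monotone T) (hbd : ∀ k, ∃ M : ℝ, ∀ τ ∈ Icc (T k) (T (k + 1)), ∀ y, ‖v τ y‖ ≤ M)
    (n : ℕ) : ∃ M : ℝ, ∀ τ ∈ Icc (T 0) (T n), ∀ y, ‖v τ y‖ ≤ M := by
  induction n with
  | zero =>
      obtain ⟨M, hM⟩ := hbd 0
      exact ⟨M, fun τ hτ y => hM τ ⟨hτ.1, hτ.2.trans (hT (Nat.zero_le 1))⟩ y⟩
  | succ n ih =>
      obtain ⟨M₁, hM₁⟩ := ih
      obtain ⟨M₂, hM₂⟩ := hbd n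
      refine ⟨max M₁ M₂, fun τ hτ y => ?_⟩
      rcases le_total τ (T n) with h | h
      · exact (hM₁ τ ⟨hτ.1, h⟩ y).trans (le_max_left _ _)
      · exact (hM₂ τ ⟨h, hτ.2⟩ y).trans (le_max_right _ _)

/-- **The Oseen equation along a chain of slabs.** If `v` is continuous and bounded on every
slab `[T k, T (k+1)] × E` of a monotone sequence of times and satisfies the Oseen integral
equation between all pairs of times of each slab, then it satisfies it between all pairs of
times of `[T 0, T n]`, for every `n` (induction on `n` with `oseenMild_glue`;
KNSS 2009, §4 (4.4)). [cite: KochNadirashviliSereginSverak2009, §4 (4.4) (arXiv:0709.3599)] -/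
theorem oseenMild_chain {v : ℝ → E → E} {T : ℕ → ℝ} (hT : Monotone T)
    (hcont : ∀ k, ContinuousOn (uncurry v) (Icc (T k) (T (k + 1)) ×ˢ univ))
    (hbd : ∀ k, ∃ M : ℝ, ∀ τ ∈ Icc (T k) (T (k + 1)), ∀ y, ‖v τ y‖ ≤ M)
    (hslab : ∀ k, ∀ s t : ℝ, T k ≤ s → s < t → t ≤ T (k + 1) → ∀ x,
      v t x = heatFlow (v s) (t - s) x - oseenDuhamel 1 s v v t x) (n : ℕ) :
    ∀ s t : ℝ, T 0 ≤ s → s < t → t ≤ T n → ∀ x,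
      v t x = heatFlow (v s) (t - s) x - oseenDuhamel 1 s v v t x := by
  induction n with
  | zero =>
      intro s t hs hst ht x
      exact absurd (hs.trans_lt hst) (not_lt.2 ht)
  | succ n ih =>
      obtain ⟨M, hM⟩ := exists_bound_chain hT hbd (n + 1)
      exact oseenMild_glue (continuousOn_uncurry_chain hT hcont (n + 1)) hM ih (hslab n)

/-- Continuity slab by slab gives continuity on the half-open union `[T 0, L) × X` whenever the
slab ends exceed every `t < L` (`ContinuousOn` is a local property; near a time `t < T n` only
the first `n` slabs matter). [folklore] -/
theorem continuousOn_uncurry_Ico_of_chain {X Y : Type*} [TopologicalSpace X] [TopologicalSpace Y]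
    {v : ℝ → X → Y} {T : ℕ → ℝ} (hT : Monotone T)
    (hcont : ∀ k, ContinuousOn (uncurry v) (Icc (T k) (T (k + 1)) ×ˢ univ)) {L : ℝ}
    (hL : ∀ t < L, ∃ n, t < T n) :
    ContinuousOn (uncurry v) (Ico (T 0) L ×ˢ univ) := by
  refine continuousOn_of_locally_continuousOn fun p hp => ?_
  rw [mem_prod, mem_Ico] at hp
  obtain ⟨n, hn⟩ := hL p.1 hp.1.2
  refine ⟨Iio (T n) ×ˢ univ, isOpen_Iio.prod isOpen_univ, ⟨hn, mem_univ _⟩, ?_⟩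
  refine (continuousOn_uncurry_chain hT hcont n).mono fun q hq => ?_
  simp only [mem_inter_iff, mem_prod, mem_Ico, mem_Iio, mem_univ, and_true] at hq
  exact ⟨⟨hq.1.1, hq.2.le⟩, mem_univ _⟩

/-- Bounds slab by slab give a bound on every `[T 0, L']` with `L' < T n` for some `n`. [folklore] -/
theorem exists_bound_Icc_of_chain {X F : Type*} [SeminormedAddCommGroup F] {v : ℝ → X → F}
    {T : ℕ → ℝ} (hT : Monotone T)
    (hbd : ∀ k, ∃ M : ℝ, ∀ τ ∈ Icc (T k) (T (k + 1)), ∀ y, ‖v τ y‖ ≤ M) {L' : ℝ} {n : ℕ}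
    (hn : L' ≤ T n) : ∃ M : ℝ, ∀ τ ∈ Icc (T 0) L', ∀ y, ‖v τ y‖ ≤ M := by
  obtain ⟨M, hM⟩ := exists_bound_chain hT hbd n
  exact ⟨M, fun τ hτ y => hM τ ⟨hτ.1, hτ.2.trans hn⟩ y⟩

/-- The Oseen equation slab by slab gives the Oseen equation between all pairs `s < t` of
`[T 0, L)` whenever the slab ends exceed every `t < L`. [cite: KochNadirashviliSereginSverak2009, §4 (4.4) (arXiv:0709.3599)] -/
theorem oseenMild_of_chain {v : ℝ → E → E} {T : ℕ → ℝ} (hT : Monotone T)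
    (hcont : ∀ k, ContinuousOn (uncurry v) (Icc (T k) (T (k + 1)) ×ˢ univ))
    (hbd : ∀ k, ∃ M : ℝ, ∀ τ ∈ Icc (T k) (T (k + 1)), ∀ y, ‖v τ y‖ ≤ M)
    (hslab : ∀ k, ∀ s t : ℝ, T k ≤ s → s < t → t ≤ T (k + 1) → ∀ x,
      v t x = heatFlow (v s) (t - s) x - oseenDuhamel 1 s v v t x) {L : ℝ}
    (hL : ∀ t < L, ∃ n, t < T n) :
    ∀ s t : ℝ, T 0 ≤ s → s < t → t < L → ∀ x,
      v t x = heatFlow (v s) (t - s) x - oseenDuhamel 1 s v v t x := by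
  intro s t hs hst ht x
  obtain ⟨n, hn⟩ := hL t ht
  exact oseenMild_chain hT hcont hbd hslab n s t hs hst hn.le x

end Literature.Analysis.FluidPDE

end
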